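import Summits.QuantumFields.YangMills.Theorems.IsotropyFromPowerCountingTemperedCurvatureMomentsThreeSlotRegularityPart1

/-!
# Three-slot regularity, Part 2: decay of plane-wave values — stub `stub_threeSlotRegularity` of reshape 4 of
`Cruxes/TemperedCurvatureMoments/Lines/Sketch.lean` (crux stmt-QuantumFields-17721, line `Sketch`)

Support file (Part 2) for stub C `stub_threeSlotRegularity`.  For a continuous functional `Λ` on `𝓢(Eⁿ, ℂ)` and
tensors of cut-off plane waves `ψ_a = ⊗ᵢ e_{aᵢ} χᵢ` (`e_a = 𝐞(-⟪a, ·⟫)`):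

* `abs_inner_pow_mul_norm_tensorFin_le` — per-slot decay: a pure-derivative slot bound in slot `k` along `t`
  gives `|⟪a_k, t⟫|ᴺ ‖Λ ψ_a‖ ≤ ∏ᵢ (2π)^{M₀}(1+‖aᵢ‖)^{M₀} Sᵢ` (the `n`-slot copy of crux 11687's
  `abs_inner_pow_mul_norm_tensor_le`, via `pow_mul_norm_apply_planeWave_le` on the slot functional);
* `lineDerivOp_const_tensorFin_planeWave` — the Leibniz step along a diagonal direction `(u,…,u)`;
* `abs_inner_sum_pow_mul_norm_tensorFin_le` — decay in the TOTAL frequency `|⟪Σᵢ aᵢ, u⟫|ᴺ ‖Λ ψ_a‖ ≤ nᴺ ∏ᵢ …` from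
  the translation identity `Λ(∂_{(u,…,u)} ⊗ f) = 0` and the order-zero bound (induction on `N` over multi-orders).
[folklore]
-/

noncomputable section

namespace Summit.QuantumFields.YangMills.Theorems.TemperedCurvatureMoments.Sketch

namespace ThreeSlotRegularity

open scoped BigOperators SchwartzMap LineDeriv FourierTransform RealInnerProductSpace
open MeasureTheory Filter Topology Set Real
open Literature.MathematicalPhysics.QuantumFieldTheory Literature.MathematicalPhysics.QuantumLattice
open Literature.MathematicalPhysics.AQFT
open Summit.QuantumFields.YangMills.Theorems.CurvatureKernel (pow_mul_norm_apply_planeWave_le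
  abs_pow_mul_le_of_two_pi schwartzNorm_fourierChar_mul_le smulLeftCLM_fourierChar_apply
  lineDerivOp_smulLeftCLM_fourierChar tsupport_planeWave_iterate_subset tsupport_smulLeftCLM_fourierChar_subset)

variable {E : Type*} [NormedAddCommGroup E] [InnerProductSpace ℝ E] {n : ℕ}

/-! ## Per-slot decay of the plane-wave values -/

/-- Schwartz norms of cut-off plane waves on derived cut-offs: if `|∂ᵐχ|_{M₀} ≤ S` then
`|e_a ∂ᵐχ|_{M₀} ≤ (2π)^{M₀} (1 + ‖a‖)^{M₀} S`. [folklore] -/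
theorem schwartzNorm_planeWave_iterate_le {M₀ : ℕ} {v : E} {χ : 𝓢(E, ℂ)} {S : ℝ} {m : ℕ}
    (hS : schwartzNorm M₀ (((∂_{v} : 𝓢(E, ℂ) → 𝓢(E, ℂ))^[m]) χ) ≤ S) (a : E) :
    schwartzNorm M₀ (SchwartzMap.smulLeftCLM ℂ (fun y : E => (𝐞 (-⟪a, y⟫) : ℂ))
      (((∂_{v} : 𝓢(E, ℂ) → 𝓢(E, ℂ))^[m]) χ)) ≤ (2 * π) ^ M₀ * (1 + ‖a‖) ^ M₀ * S :=
  (schwartzNorm_fourierChar_mul_le M₀ _ a _ (fun x => smulLeftCLM_fourierChar_apply a _ x)).trans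
    (by gcongr)

/-- **Per-slot decay.** Let `Λ` obey the pure-derivative slot bound in slot `k` along `t`:
`‖Λ(⊗ update f k (∂_tᴺ f_k))‖ ≤ ∏ᵢ |fᵢ|_{M₀}` for `N ≤ N₁` and factors supported in `Uᵢ`.  Then for
cut-offs `χᵢ` supported in `Uᵢ` with `|∂_tᵐ χᵢ|_{M₀} ≤ Sᵢ` (`m ≤ N₁`) and all frequencies `a`,
`|⟪a_k, t⟫|ᴺ ‖Λ(⊗ᵢ e_{aᵢ} χᵢ)‖ ≤ ∏ᵢ (2π)^{M₀} (1 + ‖aᵢ‖)^{M₀} Sᵢ` (`pow_mul_norm_apply_planeWave_le` for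
the slot functional `g ↦ Λ(⊗ update (e_a χ) k g)`). [folklore] -/
theorem abs_inner_pow_mul_norm_tensorFin_le (Λ : 𝓢((Fin n → E), ℂ) →L[ℂ] ℂ) {U : Fin n → Set E}
    {M₀ N₁ : ℕ} {t : E} {k : Fin n}
    (hΛ : ∀ N ≤ N₁, ∀ f : Fin n → 𝓢(E, ℂ), (∀ i, tsupport (f i : E → ℂ) ⊆ U i) →
      ‖Λ (SchwartzMap.tensorFin n (Function.update f k (((∂_{t} : 𝓢(E, ℂ) → 𝓢(E, ℂ))^[N]) (f k))))‖ ≤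
        ∏ i, schwartzNorm M₀ (f i))
    {χ : Fin n → 𝓢(E, ℂ)} (hχ : ∀ i, tsupport (χ i : E → ℂ) ⊆ U i) {S : Fin n → ℝ}
    (hS : ∀ i, ∀ m ≤ N₁, schwartzNorm M₀ (((∂_{t} : 𝓢(E, ℂ) → 𝓢(E, ℂ))^[m]) (χ i)) ≤ S i)
    (a : Fin n → E) {N : ℕ} (hN : N ≤ N₁) :
    |⟪a k, t⟫| ^ N * ‖Λ (SchwartzMap.tensorFin n (fun i =>
        SchwartzMap.smulLeftCLM ℂ (fun y : E => (𝐞 (-⟪a i, y⟫) : ℂ)) (χ i)))‖ ≤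
      ∏ i, ((2 * π) ^ M₀ * (1 + ‖a i‖) ^ M₀ * S i) := by
  set g : Fin n → 𝓢(E, ℂ) := fun i => SchwartzMap.smulLeftCLM ℂ (fun y : E => (𝐞 (-⟪a i, y⟫) : ℂ)) (χ i) with hg
  set D : ℝ := ∏ i, ((2 * π) ^ M₀ * (1 + ‖a i‖) ^ M₀ * S i) with hD
  have hS0 : ∀ i, 0 ≤ S i := fun i => (schwartzNorm_nonneg _ _).trans (hS i 0 (Nat.zero_le _))
  -- the slot functional `g' ↦ Λ(⊗ update g k g')`
  let ℓ : 𝓢(E, ℂ) →ₗ[ℂ] ℂ :=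
    { toFun := fun g' => Λ (SchwartzMap.tensorFin n (Function.update g k g'))
      map_add' := fun g₁ g₂ => by simp only [tensorFin_update_add, map_add]
      map_smul' := fun c g' => by simp only [tensorFin_update_smul, map_smul, RingHom.id_apply, smul_eq_mul] }
  have hℓ : ∀ g', ℓ g' = Λ (SchwartzMap.tensorFin n (Function.update g k g')) := fun g' => rfl
  have hyp : ∀ n' m : ℕ, n' + m ≤ N₁ → ‖ℓ (((∂_{t} : 𝓢(E, ℂ) → 𝓢(E, ℂ))^[n'])
      (SchwartzMap.smulLeftCLM ℂ (fun y : E => (𝐞 (-⟪a k, y⟫) : ℂ))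
        (((∂_{t} : 𝓢(E, ℂ) → 𝓢(E, ℂ))^[m]) (χ k))))‖ ≤ D := by
    intro n' m hnm
    rw [hℓ]
    set f' : Fin n → 𝓢(E, ℂ) := Function.update g k (SchwartzMap.smulLeftCLM ℂ
      (fun y : E => (𝐞 (-⟪a k, y⟫) : ℂ)) (((∂_{t} : 𝓢(E, ℂ) → 𝓢(E, ℂ))^[m]) (χ k))) with hf'
    have hupd : Function.update g k (((∂_{t} : 𝓢(E, ℂ) → 𝓢(E, ℂ))^[n'])
        (SchwartzMap.smulLeftCLM ℂ (fun y : E => (𝐞 (-⟪a k, y⟫) : ℂ))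
          (((∂_{t} : 𝓢(E, ℂ) → 𝓢(E, ℂ))^[m]) (χ k)))) =
        Function.update f' k (((∂_{t} : 𝓢(E, ℂ) → 𝓢(E, ℂ))^[n']) (f' k)) := by
      rw [hf', Function.update_idem, Function.update_self]
    have hsupp : ∀ i, tsupport (f' i : E → ℂ) ⊆ U i := by
      intro i
      by_cases hi : i = k
      · subst hi
        rw [hf', Function.update_self]
        exact (tsupport_planeWave_iterate_subset (a i) t m (χ i)).trans (hχ i)
      · rw [hf', Function.update_of_ne hi, hg]
        exact (tsupport_smulLeftCLM_fourierChar_subset (a i) (χ i)).trans (hχ i)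
    rw [hupd]
    refine (hΛ n' (by omega) f' hsupp).trans ?_
    rw [hD]
    refine Finset.prod_le_prod (fun i _ => schwartzNorm_nonneg _ _) fun i _ => ?_
    by_cases hi : i = k
    · subst hi
      rw [hf', Function.update_self]
      exact schwartzNorm_planeWave_iterate_le (hS i m (by omega)) (a i)
    · rw [hf', Function.update_of_ne hi, hg]
      simpa using schwartzNorm_planeWave_iterate_le (m := 0) (v := t) (by simpa using hS i 0 (Nat.zero_le _)) (a i)
  have h := pow_mul_norm_apply_planeWave_le (a k) t (χ k) D N ℓ N₁ hyp 0 (by simpa using hN)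
  rw [hℓ] at h
  simp only [Function.iterate_zero, id_eq] at h
  have hgk : Function.update g k (SchwartzMap.smulLeftCLM ℂ (fun y : E => (𝐞 (-⟪a k, y⟫) : ℂ)) (χ k)) = g := by
    rw [hg]
    exact Function.update_eq_self k _
  rw [hgk] at h
  exact abs_pow_mul_le_of_two_pi (norm_nonneg _) h

/-! ## Decay in the total frequency from translation invariance -/

/-- One Leibniz step for tensors of cut-off plane waves along a diagonal direction:
`∂_{(u,…,u)} (⊗ᵢ e_{aᵢ} φᵢ) = Σ_k ⊗ (update (e_a φ) k (e_{a_k} ∂_u φ_k)) − 2πi ⟪Σᵢ aᵢ, u⟫ ⊗ᵢ e_{aᵢ} φᵢ`. [folklore] -/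
theorem lineDerivOp_const_tensorFin_planeWave (u : E) (a : Fin n → E) (φ : Fin n → 𝓢(E, ℂ)) :
    (∂_{(fun _ : Fin n => u)} (SchwartzMap.tensorFin n (fun i =>
        SchwartzMap.smulLeftCLM ℂ (fun y : E => (𝐞 (-⟪a i, y⟫) : ℂ)) (φ i))) : 𝓢((Fin n → E), ℂ)) =
      ∑ k, SchwartzMap.tensorFin n (Function.update
          (fun i => SchwartzMap.smulLeftCLM ℂ (fun y : E => (𝐞 (-⟪a i, y⟫) : ℂ)) (φ i)) k
          (SchwartzMap.smulLeftCLM ℂ (fun y : E => (𝐞 (-⟪a k, y⟫) : ℂ)) (∂_{u} (φ k)))) +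
        (-(2 * π * Complex.I * (⟪∑ i, a i, u⟫ : ℝ))) • SchwartzMap.tensorFin n (fun i =>
          SchwartzMap.smulLeftCLM ℂ (fun y : E => (𝐞 (-⟪a i, y⟫) : ℂ)) (φ i)) := by
  set g : Fin n → 𝓢(E, ℂ) := fun i => SchwartzMap.smulLeftCLM ℂ (fun y : E => (𝐞 (-⟪a i, y⟫) : ℂ)) (φ i) with hg
  rw [lineDerivOp_tensorFin]
  have hk : ∀ k, SchwartzMap.tensorFin n (Function.update g k (∂_{u} (g k))) =
      SchwartzMap.tensorFin n (Function.update g k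
        (SchwartzMap.smulLeftCLM ℂ (fun y : E => (𝐞 (-⟪a k, y⟫) : ℂ)) (∂_{u} (φ k)))) +
      (-(2 * π * Complex.I * (⟪a k, u⟫ : ℝ))) • SchwartzMap.tensorFin n g := by
    intro k
    have h1 : (∂_{u} (g k) : 𝓢(E, ℂ)) = SchwartzMap.smulLeftCLM ℂ (fun y : E => (𝐞 (-⟪a k, y⟫) : ℂ)) (∂_{u} (φ k)) +
        (-(2 * π * Complex.I * (⟪a k, u⟫ : ℝ))) • g k := by
      rw [hg]
      exact lineDerivOp_smulLeftCLM_fourierChar (a k) u (φ k)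
    rw [h1, tensorFin_update_add, tensorFin_update_smul, Function.update_eq_self]
  simp only [hk, Finset.sum_add_distrib]
  congr 1
  rw [← Finset.sum_smul, sum_inner, Complex.ofReal_sum, Finset.mul_sum, ← Finset.sum_neg_distrib]

/-- **Decay in the total frequency from translation invariance** (inductive form).  Suppose
`‖Λ(⊗ f)‖ ≤ ∏ |fᵢ|_{M₀}` and `Λ(∂_{(u,…,u)} ⊗ f) = 0` for all factors supported in `Uᵢ`.  Then for
cut-offs `χᵢ ⊆ Uᵢ` with `|∂_uᵐ χᵢ|_{M₀} ≤ Sᵢ` (`m ≤ N₁`), all multi-orders `m` and `N + Σ mᵢ ≤ N₁`: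
`(2π |⟪Σ aᵢ, u⟫|)ᴺ ‖Λ(⊗ᵢ e_{aᵢ} ∂_u^{mᵢ} χᵢ)‖ ≤ nᴺ ∏ᵢ (2π)^{M₀}(1+‖aᵢ‖)^{M₀} Sᵢ`. [folklore] -/
theorem two_pi_abs_inner_sum_pow_mul_norm_le (Λ : 𝓢((Fin n → E), ℂ) →L[ℂ] ℂ) {U : Fin n → Set E}
    {M₀ N₁ : ℕ} (u : E)
    (h0 : ∀ f : Fin n → 𝓢(E, ℂ), (∀ i, tsupport (f i : E → ℂ) ⊆ U i) →
      ‖Λ (SchwartzMap.tensorFin n f)‖ ≤ ∏ i, schwartzNorm M₀ (f i))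
    (hvan : ∀ f : Fin n → 𝓢(E, ℂ), (∀ i, tsupport (f i : E → ℂ) ⊆ U i) →
      Λ (∂_{(fun _ : Fin n => u)} (SchwartzMap.tensorFin n f)) = 0)
    {χ : Fin n → 𝓢(E, ℂ)} (hχ : ∀ i, tsupport (χ i : E → ℂ) ⊆ U i) {S : Fin n → ℝ}
    (hS : ∀ i, ∀ m ≤ N₁, schwartzNorm M₀ (((∂_{u} : 𝓢(E, ℂ) → 𝓢(E, ℂ))^[m]) (χ i)) ≤ S i)
    (a : Fin n → E) :
    ∀ (N : ℕ) (m : Fin n → ℕ), N + ∑ i, m i ≤ N₁ →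
      (2 * π * |⟪∑ i, a i, u⟫|) ^ N * ‖Λ (SchwartzMap.tensorFin n (fun i =>
        SchwartzMap.smulLeftCLM ℂ (fun y : E => (𝐞 (-⟪a i, y⟫) : ℂ))
          (((∂_{u} : 𝓢(E, ℂ) → 𝓢(E, ℂ))^[m i]) (χ i))))‖ ≤
      (n : ℝ) ^ N * ∏ i, ((2 * π) ^ M₀ * (1 + ‖a i‖) ^ M₀ * S i) := by
  set D : ℝ := ∏ i, ((2 * π) ^ M₀ * (1 + ‖a i‖) ^ M₀ * S i) with hD
  intro N
  induction N with
  | zero =>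
    intro m hm
    rw [pow_zero, one_mul, pow_zero, one_mul]
    refine (h0 _ fun i => (tsupport_planeWave_iterate_subset (a i) u (m i) (χ i)).trans (hχ i)).trans ?_
    refine Finset.prod_le_prod (fun i _ => schwartzNorm_nonneg _ _) fun i _ => ?_
    refine schwartzNorm_planeWave_iterate_le (hS i (m i) ?_) (a i)
    have := Finset.single_le_sum (f := m) (fun j _ => Nat.zero_le _) (Finset.mem_univ i)
    omega
  | succ N ih =>
    intro m hm
    set φ : Fin n → 𝓢(E, ℂ) := fun i => ((∂_{u} : 𝓢(E, ℂ) → 𝓢(E, ℂ))^[m i]) (χ i) with hφ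
    set g : Fin n → 𝓢(E, ℂ) := fun i => SchwartzMap.smulLeftCLM ℂ (fun y : E => (𝐞 (-⟪a i, y⟫) : ℂ)) (φ i)
      with hg
    set c : ℂ := -(2 * π * Complex.I * (⟪∑ i, a i, u⟫ : ℝ)) with hc
    have hnc : ‖c‖ = 2 * π * |⟪∑ i, a i, u⟫| := by
      rw [hc, norm_neg, norm_mul, norm_mul, norm_mul, Complex.norm_real, Complex.norm_I, Complex.norm_two,
        Complex.norm_real, Real.norm_of_nonneg Real.pi_pos.le, Real.norm_eq_abs, mul_one]
    -- the terms after one Leibniz step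
    set T : Fin n → 𝓢((Fin n → E), ℂ) := fun k => SchwartzMap.tensorFin n (Function.update g k
      (SchwartzMap.smulLeftCLM ℂ (fun y : E => (𝐞 (-⟪a k, y⟫) : ℂ)) (∂_{u} (φ k)))) with hT
    have hLeib : (∂_{(fun _ : Fin n => u)} (SchwartzMap.tensorFin n g) : 𝓢((Fin n → E), ℂ)) =
        ∑ k, T k + c • SchwartzMap.tensorFin n g := lineDerivOp_const_tensorFin_planeWave u a φ
    have hvan' : Λ (∂_{(fun _ : Fin n => u)} (SchwartzMap.tensorFin n g)) = 0 :=
      hvan g fun i => (tsupport_planeWave_iterate_subset (a i) u (m i) (χ i)).trans (hχ i)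
    have hid : c * Λ (SchwartzMap.tensorFin n g) = -∑ k, Λ (T k) := by
      rw [hLeib, map_add, map_sum, map_smul, smul_eq_mul] at hvan'
      linear_combination hvan'
    have hnorm : ‖c‖ * ‖Λ (SchwartzMap.tensorFin n g)‖ ≤ ∑ k, ‖Λ (T k)‖ := by
      rw [← norm_mul, hid, norm_neg]
      exact norm_sum_le _ _
    -- each term is a tensor of plane waves on derived cut-offs with one more derivative
    have hTk : ∀ k, T k = SchwartzMap.tensorFin n (fun i =>
        SchwartzMap.smulLeftCLM ℂ (fun y : E => (𝐞 (-⟪a i, y⟫) : ℂ))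
          (((∂_{u} : 𝓢(E, ℂ) → 𝓢(E, ℂ))^[Function.update m k (m k + 1) i]) (χ i))) := by
      intro k
      simp only [hT]
      congr 1
      funext i
      by_cases hi : i = k
      · subst hi
        rw [Function.update_self, Function.update_self, Function.iterate_succ_apply']
      · rw [Function.update_of_ne hi, Function.update_of_ne hi]
    have hmk : ∀ k, N + ∑ i, Function.update m k (m k + 1) i ≤ N₁ := by
      intro k
      rw [Finset.sum_update_of_mem (Finset.mem_univ k), Finset.sdiff_singleton_eq_erase]
      have := Finset.add_sum_erase Finset.univ m (Finset.mem_univ k)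
      omega
    have hbound : ∀ k, (2 * π * |⟪∑ i, a i, u⟫|) ^ N * ‖Λ (T k)‖ ≤ (n : ℝ) ^ N * D := by
      intro k
      rw [hTk k]
      exact ih _ (hmk k)
    calc (2 * π * |⟪∑ i, a i, u⟫|) ^ (N + 1) * ‖Λ (SchwartzMap.tensorFin n g)‖
        = (2 * π * |⟪∑ i, a i, u⟫|) ^ N * (‖c‖ * ‖Λ (SchwartzMap.tensorFin n g)‖) := by rw [hnc]; ring
      _ ≤ (2 * π * |⟪∑ i, a i, u⟫|) ^ N * ∑ k, ‖Λ (T k)‖ := by gcongr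
      _ = ∑ k, (2 * π * |⟪∑ i, a i, u⟫|) ^ N * ‖Λ (T k)‖ := Finset.mul_sum _ _ _
      _ ≤ ∑ _k : Fin n, (n : ℝ) ^ N * D := Finset.sum_le_sum fun k _ => hbound k
      _ = (n : ℝ) ^ (N + 1) * D := by rw [Finset.sum_const, Finset.card_univ, Fintype.card_fin, nsmul_eq_mul]; ring

/-- **Decay in the total frequency from translation invariance.** Under the hypotheses of
`two_pi_abs_inner_sum_pow_mul_norm_le`: `|⟪Σᵢ aᵢ, u⟫|ᴺ ‖Λ(⊗ᵢ e_{aᵢ} χᵢ)‖ ≤ nᴺ ∏ᵢ (2π)^{M₀}(1+‖aᵢ‖)^{M₀} Sᵢ`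
for `N ≤ N₁`. [folklore] -/
theorem abs_inner_sum_pow_mul_norm_tensorFin_le (Λ : 𝓢((Fin n → E), ℂ) →L[ℂ] ℂ) {U : Fin n → Set E}
    {M₀ N₁ : ℕ} (u : E)
    (h0 : ∀ f : Fin n → 𝓢(E, ℂ), (∀ i, tsupport (f i : E → ℂ) ⊆ U i) →
      ‖Λ (SchwartzMap.tensorFin n f)‖ ≤ ∏ i, schwartzNorm M₀ (f i))
    (hvan : ∀ f : Fin n → 𝓢(E, ℂ), (∀ i, tsupport (f i : E → ℂ) ⊆ U i) →
      Λ (∂_{(fun _ : Fin n => u)} (SchwartzMap.tensorFin n f)) = 0)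
    {χ : Fin n → 𝓢(E, ℂ)} (hχ : ∀ i, tsupport (χ i : E → ℂ) ⊆ U i) {S : Fin n → ℝ}
    (hS : ∀ i, ∀ m ≤ N₁, schwartzNorm M₀ (((∂_{u} : 𝓢(E, ℂ) → 𝓢(E, ℂ))^[m]) (χ i)) ≤ S i)
    (a : Fin n → E) {N : ℕ} (hN : N ≤ N₁) :
    |⟪∑ i, a i, u⟫| ^ N * ‖Λ (SchwartzMap.tensorFin n (fun i =>
        SchwartzMap.smulLeftCLM ℂ (fun y : E => (𝐞 (-⟪a i, y⟫) : ℂ)) (χ i)))‖ ≤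
      (n : ℝ) ^ N * ∏ i, ((2 * π) ^ M₀ * (1 + ‖a i‖) ^ M₀ * S i) := by
  have h := two_pi_abs_inner_sum_pow_mul_norm_le Λ u h0 hvan hχ hS a N (fun _ => 0) (by simpa using hN)
  simp only [Function.iterate_zero, id_eq] at h
  have hS0 : ∀ i, 0 ≤ S i := fun i => (schwartzNorm_nonneg _ _).trans (hS i 0 (Nat.zero_le _))
  have hg := norm_nonneg (Λ (SchwartzMap.tensorFin n (fun i =>
        SchwartzMap.smulLeftCLM ℂ (fun y : E => (𝐞 (-⟪a i, y⟫) : ℂ)) (χ i))))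
  have h2 : |⟪∑ i, a i, u⟫| ^ N ≤ (2 * π * |⟪∑ i, a i, u⟫|) ^ N := by
    refine pow_le_pow_left₀ (abs_nonneg _) ?_ N
    have : (1 : ℝ) ≤ 2 * π := by nlinarith [Real.pi_gt_three]
    nlinarith [abs_nonneg ⟪∑ i, a i, u⟫]
  exact (mul_le_mul_of_nonneg_right h2 hg).trans h

end ThreeSlotRegularity

end Summit.QuantumFields.YangMills.Theorems.TemperedCurvatureMoments.Sketch
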